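import Mathlib
import Summits.AtomisticToContinuum.Crystallization.Theorems.FrustratedLawDichotomyPeriodicMuGSC
import Literature.MathematicalPhysics.StatisticalMechanics.CrystallizationLocalLimit

/-!
# FrustratedLawDichotomy · cruxes 27623 / 27624 — exact periodic Lennard-Jones minimisers are `e⋆`-μGSCs, HYPOTHESIS-FREE form
# (decomp-a2c, prover hand 2, structural share, generation 5)

`FrustratedLawDichotomyPeriodicMuGSC.isMuGSC_points_of_energyPerParticle_le` carries the cell's standing `δ`-separation hypothesis; for a
periodic configuration it is automatic (`Literature…CrystallizationLocalLimit.PeriodicConfiguration.exists_pos_le_dist`: a discrete lattice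
and a finite motif give a uniform separation).  `isMuGSC_points_of_exact_periodic_minimiser`: EVERY periodic configuration `Q` of `ℝ³` with
`e(Q) ≤ e⋆` (equivalently `e(Q) = e⋆`, an exact minimiser among periodic configurations) has an `e⋆`-μ-ground-state point set for `V_LJ`
(Sütő): no finite surgery lowers `U − e⋆·#`.  Unconditional; the periodic case of item 27073.  `[folklore]`.
-/

noncomputable section

namespace Summit.AtomisticToContinuum.Crystallization.Theorems.FrustratedLawDichotomyPeriodicMuGSC

open Literature.MathematicalPhysics.StatisticalMechanics

/-- **Exact periodic Lennard-Jones minimisers are `e⋆`-μGSCs** (no separation hypothesis: periodic point sets are uniformly discrete).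
[folklore] -/
theorem isMuGSC_points_of_exact_periodic_minimiser (Q : PeriodicConfiguration 3)
    (hopt : Q.energyPerParticle lennardJones ≤ ⨅ Q' : PeriodicConfiguration 3, Q'.energyPerParticle lennardJones) :
    IsMuGSC lennardJones (⨅ Q' : PeriodicConfiguration 3, Q'.energyPerParticle lennardJones) Q.points := by
  obtain ⟨δ, hδ, hsep⟩ := Q.exists_pos_le_dist
  exact isMuGSC_points_of_energyPerParticle_le Q hδ hsep hopt

/-- The same under the `IsLeast` form of exact minimality. [folklore] -/
theorem isMuGSC_points_of_isLeast (Q : PeriodicConfiguration 3)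
    (hleast : IsLeast (Set.range fun Q' : PeriodicConfiguration 3 => Q'.energyPerParticle lennardJones)
      (Q.energyPerParticle lennardJones)) :
    IsMuGSC lennardJones (⨅ Q' : PeriodicConfiguration 3, Q'.energyPerParticle lennardJones) Q.points := by
  refine isMuGSC_points_of_exact_periodic_minimiser Q (le_ciInf fun Q' => hleast.2 ⟨Q', rfl⟩)

end Summit.AtomisticToContinuum.Crystallization.Theorems.FrustratedLawDichotomyPeriodicMuGSC

end
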